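import Summits.CriticalPhenomena.PercolationContinuityZ3.Theorems.PercNearOneGluingNoHeavyQuantSliceLawSWCore
import Summits.CriticalPhenomena.PercolationContinuityZ3.Theorems.PercNearOneGluingNoHeavyQuantBandTwoBlobDEC
import HarnessLib

/-!
# QUANT lane R8, T-DEC: **`LawDec.sliceLawSW_holds : SliceLawSW`** — census-2 g55's law-level LEMMA W is a theorem; hence
# **`sliceSingleLayer_holds`, `sliceClosedAll_holds`, `sliceClosedWindowT_holds`**: single-layer domination and the slice-closure statements of
# record hold for EVERY gate `x ≤ g < 1`

builds on p205010 (kernel theorem, internal audit signed; external expert review pending)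

Support file (`--supports stmt-CriticalPhenomena-4575`), QUANT lane typer seat prim-quant-stmt (gen 24), rung R8 of
`run/shared/lean/prim/quant/LADDER.md`.  Theorems only, standard axioms, no sorries.  Assembles parts 1–5 (`…QuantSliceLawSWFlow/Poly/Cells/Numerics/Core`,
this seat), the band piece (`…QuantBandTwoBlobDEC`, this seat; census-1 g19), BLOB-DEC(2)'s heavy pairs (`slice_heavyPair_decAtT`, typer g22) and
census-2 g55's reduction chain (`…QuantSliceSingleLayer`, `…Reduction`, `…Laws`: `sliceSingleLayer_of_lawSW`, `sliceClosedAll_of_lawSW`,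
`sliceClosedWindowT_of_lawSW`, `sliceMidLemmaW_of_lawSW`).

THE CASES of `SliceLawSW` (low `l`, window absorber `h`, window position `h′ ≥ h`, `γ = pairGate x T l h`):
* HEAVY pair (`x ≤ γ`): `t = 0`; the law is the slice of `{l, h; γ}`, DEC by `slice_heavyPair_decAtT`.
* LIGHT pair, `h` band-like at the raised target (`2h < T + ag`): `t = 0`; the law is the shifted four-atom law of `bandTwoBlobDEC_holds`.
* LIGHT pair, `h` self-sufficient at the raised target, `h′ = h`: `sliceLawSW_core` (explicit transfer, ten certified cells).
* LIGHT pair, `h′ > h`: the core case's witness with mass `t(1−g)` moved from `h` up to the cheaper mid `h′` (`FlowAtT.shift_absorber_up`).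

CONSEQUENCES (README V264/V268; LEAD-NOTES-G22/G23; census-2 g54/g55): `LawDec.SliceSingleLayer` (every slice price system is dominated by ONE window
layer), `LawDec.SliceDominated`, `LawDec.SliceClosedAll` (the slice of an all-layer-DEC top-affordable probability law by a heavy blob is DEC at every
window layer — the law-level statement of record of the slice step, for EVERY `x ≤ g < 1`, not only `g ≥ 1/2`), `LawDec.SliceClosedWindowT`, and
**BLOB-DEC(k) for every k** (`blobDEC_holds`, `blobDEC_on_holds`: the law of any finite sum of independent heavy blobs is DEC at every layer) are THEOREMS.
HONEST: these are law-level (one slice step); `TreeBuiltDEC` / `TreeDEC` / `FarTreeRow`, the gate interaction and the convolution version remain OPEN;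
the RATE class log\* and the honest sentence are unchanged.

[this work]; nothing here is cited as a published result.  The gluing rows served [cite: KozmaNitzan2024, Conjecture 3 (p. 15)]; product measure
[cite: Grimmett1999, §1.3 p. 10].
-/

noncomputable section

namespace Summit.CriticalPhenomena.PercolationContinuityZ3.Theorems

namespace Quant

open Finset

/-- the two-point law `{lo, hi; g}` (as in `…QuantLawDEC`) -/
local notation3 "TP[" lo ", " hi ", " g ", " h "]" =>
  (g : ℝ) * (if (h : ℕ) = (hi : ℕ) then (1 : ℝ) else 0) + (1 - (g : ℝ)) * (if (h : ℕ) = (lo : ℕ) then (1 : ℝ) else 0)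

/-- the two-blob law `(1−u)(1−v)δ₀ + u(1−v)δ_a + (1−u)vδ_b + uvδ_{a+b}` evaluated at `h` (as in `…QuantBlobDecTwoLawParts`) -/
local notation3 "LAW2[" a ", " u ", " b ", " v ", " h "]" =>
  (1 - (u : ℝ)) * (1 - (v : ℝ)) * (if (h : ℕ) = 0 then (1 : ℝ) else 0)
    + (u : ℝ) * (1 - (v : ℝ)) * (if (h : ℕ) = (a : ℕ) then (1 : ℝ) else 0)
    + (1 - (u : ℝ)) * (v : ℝ) * (if (h : ℕ) = (b : ℕ) then (1 : ℝ) else 0)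
    + (u : ℝ) * (v : ℝ) * (if (h : ℕ) = (a : ℕ) + (b : ℕ) then (1 : ℝ) else 0)

namespace LawDec

/-- without transfer the law of `SliceLawSW` is the slice of the pair (for any `h′`). [this work] -/
theorem swLaw_zero_eq_slice (γ g : ℝ) (l h h' a : ℕ) :
    swLaw γ g 0 l h h' a = slice (fun t => TP[l, h, γ, t]) a g := by
  funext p
  rw [slice_TP]
  simp only [swLaw]
  ring

/-- the slice of a pair as a shifted two-blob law (as `slice_pair_eq_shift_law2` in `…QuantNoGiantClosure`). [this work] -/
theorem slice_pair_shift (l b a : ℕ) (γ g : ℝ) :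
    slice (fun t => TP[l, l + b, γ, t]) a g = fun p => if l ≤ p then LAW2[b, γ, a, g, p - l] else 0 := by
  funext p
  rw [slice_TP]
  by_cases hlp : l ≤ p
  · rw [if_pos hlp]
    have e0 : (p - l = 0) ↔ (p = l) := by omega
    have e1 : (p - l = b) ↔ (p = l + b) := by omega
    have e2 : (p - l = a) ↔ (p = l + a) := by omega
    have e3 : (p - l = b + a) ↔ (p = l + b + a) := by omega
    simp only [e0, e1, e2, e3]
    ring
  · rw [if_neg hlp, if_neg (by omega), if_neg (by omega), if_neg (by omega), if_neg (by omega)]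
    ring

/-- the transferred law is nonnegative, vanishes above `M + a`, and has mass `1` (`0 ≤ γ ≤ 1`, `0 ≤ g ≤ 1`, `0 ≤ t(1−g) ≤ γg`). [this work] -/
theorem swLaw_facts (γ g t : ℝ) (l h h' a M : ℕ) (hγ0 : 0 ≤ γ) (hγ1 : γ ≤ 1) (hg0 : 0 ≤ g) (hg1 : g ≤ 1) (ht0 : 0 ≤ t * (1 - g))
    (ht : t * (1 - g) ≤ γ * g) (hl : l + a ≤ M + a) (hh : h + a ≤ M + a) (hh' : h' ≤ M + a) :
    (∀ p, 0 ≤ swLaw γ g t l h h' a p) ∧ (∀ p, M + a < p → swLaw γ g t l h h' a p = 0) ∧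
      ∑ p ∈ Finset.range (M + a + 1), swLaw γ g t l h h' a p = 1 := by
  have ind_nn : ∀ (P : Prop) [Decidable P], (0:ℝ) ≤ (if P then (1:ℝ) else 0) := fun P _ => by split_ifs <;> norm_num
  refine ⟨fun p => ?_, fun p hp => ?_, ?_⟩
  · simp only [swLaw]
    have := mul_nonneg (mul_nonneg (sub_nonneg.2 hγ1) (sub_nonneg.2 hg1)) (ind_nn (p = l))
    have := mul_nonneg (mul_nonneg (sub_nonneg.2 hγ1) hg0) (ind_nn (p = l + a))
    have := mul_nonneg (mul_nonneg hγ0 (sub_nonneg.2 hg1)) (ind_nn (p = h))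
    have := mul_nonneg ht0 (ind_nn (p = h'))
    have := mul_nonneg (sub_nonneg.2 ht) (ind_nn (p = h + a))
    linarith
  · simp only [swLaw]
    rw [if_neg (by omega : p ≠ l), if_neg (by omega : p ≠ l + a), if_neg (by omega : p ≠ h), if_neg (by omega : p ≠ h'),
      if_neg (by omega : p ≠ h + a)]
    ring
  · simp only [swLaw, Finset.sum_add_distrib]
    rw [BlobDec2.sum_range_const_indicator _ l (by omega), BlobDec2.sum_range_const_indicator _ (l + a) hl,
      BlobDec2.sum_range_const_indicator _ h (by omega), BlobDec2.sum_range_const_indicator _ h' hh',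
      BlobDec2.sum_range_const_indicator _ (h + a) hh]
    ring

/-- **`SliceLawSW` HOLDS** (census-2 g55's law-level LEMMA W). [this work] -/
theorem sliceLawSW_holds : SliceLawSW := by
  intro x g T M a j' l h h' hx0 hx1 hxg hg1 ha hla hlow hwin hhh' hh'j hh'M hT2 hcomp
  have h1x : 0 < 1 - x := sub_pos.2 hx1
  have hg0 : 0 ≤ g := hx0.le.trans hxg
  have ha0 : (0 : ℝ) < a := by exact_mod_cast Nat.lt_of_lt_of_le Nat.zero_lt_one ha
  have hhj : h ≤ j' := hhh'.trans hh'j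
  have hhM : h ≤ M := hhh'.trans hh'M
  have hlh' : (l : ℝ) < h := by linarith
  have hlh : l < h := by exact_mod_cast hlh'
  have hd : (0 : ℝ) < (h : ℝ) - l := by linarith
  set γ := pairGate x T l h with hγ
  have hγ0 : 0 < γ := pairGate_pos x T l h hlow hlh
  have hγ1 : γ < 1 := pairGate_lt_one x T l h hx0 hx1 hlow hcomp
  have hργ : (T - 2 * (l : ℝ)) / ((h : ℝ) - l) ≤ γ := le_max_left _ _
  have hρT : (h : ℝ) - l > 0 := hd
  by_cases hheavy : x ≤ γ
  · -- heavy pair: no transfer, BLOB-DEC(2)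
    refine ⟨0, le_rfl, by rw [zero_mul]; exact mul_nonneg hγ0.le hg0, ?_⟩
    rw [swLaw_zero_eq_slice]
    refine slice_heavyPair_decAtT x (T + (a : ℝ) * g) g γ j' M l h a hx0 hx1 hxg hg1.le hheavy hγ1.le ha hlh hhj hhM ?_
    have : T - 2 * (l : ℝ) ≤ ((h : ℝ) - l) * γ := by
      have := (div_le_iff₀ hd).1 hργ
      linarith
    linarith
  · push Not at hheavy
    -- light pair: `ρ < x` and `γ = x² + (1−x)ρ`
    have hlight : (T - 2 * (l : ℝ)) / ((h : ℝ) - l) < x := by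
      by_contra hn
      push Not at hn
      exact absurd (le_trans hn hργ) (not_le.2 hheavy)
    have hγeq : γ = x ^ 2 + (1 - x) * ((T - 2 * (l : ℝ)) / ((h : ℝ) - l)) := pairGate_eq_light x T l h hx0.le hlight.le
    by_cases hWmid : T + (a : ℝ) * g ≤ 2 * (h : ℝ)
    · -- `h` stays self-sufficient at the raised target: the core case, shifted up to `h′` if `h′ > h`
      obtain ⟨t, ht0, ht, hdec⟩ :=
        sliceLawSW_core x g T M a j' l h hx0 hx1 hxg hg1 ha hla hlow hwin hhj hhM hT2 hcomp hlight hWmid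
      refine ⟨t, ht0, ht, ?_⟩
      rcases Nat.eq_or_lt_of_le hhh' with heq | hlt
      · rw [← heq]; exact hdec
      · have hF := flowAtT_of_decAtT x (T + (a : ℝ) * g) j' (M + a) _ hx0 hx1 hdec
        have ht0' : 0 ≤ t * (1 - g) := mul_nonneg ht0 (by linarith)
        obtain ⟨hμ0, hμM, hμ1⟩ := swLaw_facts γ g t l h h a M hγ0.le hγ1.le hg0 hg1.le ht0' ht (by omega) (by omega) (by omega)
        have hδ : t * (1 - g) ≤ swLaw γ g t l h h a h := by
          have hne1 : h ≠ l := by omega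
          have hne2 : h ≠ h + a := by omega
          have i1 : (0:ℝ) ≤ (if h = l + a then (1:ℝ) else 0) := by split_ifs <;> norm_num
          have e : swLaw γ g t l h h a h = (1 - γ) * g * (if h = l + a then (1:ℝ) else 0) + γ * (1 - g) + t * (1 - g) := by
            simp only [swLaw, hne1, hne2, if_true, if_false]
            ring
          rw [e]
          nlinarith [mul_nonneg (mul_nonneg (sub_nonneg.2 hγ1.le) hg0) i1, mul_nonneg hγ0.le (sub_nonneg.2 hg1.le)]
        have hF' := hF.shift_absorber_up hx0 hx1 hμ0 h h' hlt hh'j (by omega) hWmid (t * (1 - g)) ht0' hδ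
        have e : (fun k => swLaw γ g t l h h a k - t * (1 - g) * (if k = h then (1:ℝ) else 0)
            + t * (1 - g) * (if k = h' then (1:ℝ) else 0)) = swLaw γ g t l h h' a := by
          funext k; simp only [swLaw]; ring
        rw [e] at hF'
        obtain ⟨-, hμM', hμ1'⟩ := swLaw_facts γ g t l h h' a M hγ0.le hγ1.le hg0 hg1.le ht0' ht (by omega) (by omega) (by omega)
        exact decAtT_of_flowAtT x _ j' (M + a) _ hx0 hx1 hμM' hμ1' hF'
    · -- `h` is band-like at the raised target: no transfer, the band piece (census-1 g19)
      push Not at hWmid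
      refine ⟨0, le_rfl, by rw [zero_mul]; exact mul_nonneg hγ0.le hg0, ?_⟩
      obtain ⟨b, hb⟩ : ∃ b, h = l + b := ⟨h - l, by omega⟩
      have hb1 : 1 ≤ b := by omega
      have hbR : ((h : ℝ) - l) = b := by rw [hb]; push_cast; ring
      have hρeq : (γ - x ^ 2) / (1 - x) = (T - 2 * (l : ℝ)) / ((h : ℝ) - l) := by
        rw [hγeq]; field_simp; ring
      have hγx2 : x ^ 2 < γ := by
        rw [hγeq]
        have : 0 < (T - 2 * (l : ℝ)) / ((h : ℝ) - l) := div_pos (by linarith) hd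
        nlinarith [mul_pos h1x this]
      have hband : (b : ℝ) * (2 - (γ - x ^ 2) / (1 - x)) ≤ (a : ℝ) * g := by
        rw [hρeq, ← hbR, mul_sub, mul_div_cancel₀ _ hd.ne']
        linarith
      have hdec := bandTwoBlobDEC_holds x γ g a b (j' - l) hx0 hx1 hγx2 hheavy hxg hg1.le ha hb1 (by omega) hband
      -- shift by `l` and enlarge the support
      have hsh := decAtT_shift_two x ((b : ℝ) * ((γ - x ^ 2) / (1 - x)) + (a : ℝ) * g) (j' - l) (b + a) l _ hdec
      have hlay : j' - l + l = j' := by omega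
      have htar : (b : ℝ) * ((γ - x ^ 2) / (1 - x)) + (a : ℝ) * g + 2 * (l : ℝ) = T + (a : ℝ) * g := by
        rw [hρeq, ← hbR, mul_div_cancel₀ _ hd.ne']; ring
      rw [hlay, htar] at hsh
      have hsh' := decAtT_mono_top hsh (show b + a + l ≤ M + a by omega)
      have e : (fun p => if l ≤ p then (fun q => LAW2[b, γ, a, g, q]) (p - l) else 0) = swLaw γ g 0 l h h' a := by
        rw [swLaw_zero_eq_slice, hb, slice_pair_shift]
      rw [e] at hsh'
      exact hsh'

/-- **SINGLE-LAYER DOMINATION HOLDS** (census-2 g55's `LawDec.SliceSingleLayer`). [this work] -/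
theorem sliceSingleLayer_holds : SliceSingleLayer :=
  sliceSingleLayer_of_lawSW sliceLawSW_holds

/-- **LEMMA W HOLDS.** [this work] -/
theorem sliceMidLemmaW_holds : SliceMidLemmaW :=
  sliceMidLemmaW_of_lawSW sliceLawSW_holds

/-- **THE SLICE-CLOSURE STATEMENT OF RECORD HOLDS FOR EVERY GATE**: `LawDec.SliceClosedAll` (the slice of an all-layer-DEC top-affordable
probability law by a heavy blob `(a, g)`, `x ≤ g < 1`, is DEC at every window layer). [this work] -/
theorem sliceClosedAll_holds : SliceClosedAll :=
  sliceClosedAll_of_lawSW sliceLawSW_holds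

/-- **the window form of record holds**: `LawDec.SliceClosedWindowT`. [this work] -/
theorem sliceClosedWindowT_holds : SliceClosedWindowT :=
  sliceClosedWindowT_of_lawSW sliceLawSW_holds

/-- **single-layer domination with tilt (`LawDec.SliceDominated`, census-2 g54) holds.** [this work] -/
theorem sliceDominated_holds : SliceDominated :=
  sliceDominated_of_singleLayer sliceSingleLayer_holds

/-- **BLOB-DEC(k) FOR EVERY k**: for every floor `0 < x`, the law of any finite sum of independent blobs with sizes `≥ 1` and gates in `[x, 1)`
is DEC(j′) at floor `x` for EVERY layer `j′` (census-2 g53/g54's `blobDEC_of_sliceClosedAll`, now unconditional). [this work] -/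
theorem blobDEC_holds (x : ℝ) (hx0 : 0 < x) :
    ∀ (l : List (ℕ × ℝ)), (∀ p ∈ l, 1 ≤ p.1 ∧ x ≤ p.2 ∧ p.2 < 1) → ∀ j', DECAt x j' (blobTop l) (blobLaw l) :=
  blobDEC_of_sliceClosedAll sliceClosedAll_holds x hx0

/-- **BLOB-DEC(k) for every k, indexed form** (`blobLawOn`). [this work] -/
theorem blobDEC_on_holds {ι : Type*} [DecidableEq ι] (x : ℝ) (hx0 : 0 < x) (s : Finset ι) (a : ι → ℕ) (p : ι → ℝ)
    (hs : ∀ i ∈ s, 1 ≤ a i ∧ x ≤ p i ∧ p i < 1) (j' : ℕ) :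
    DECAt x j' (∑ i ∈ s, a i) (blobLawOn s a p) :=
  blobDEC_on_of_sliceClosedAll sliceClosedAll_holds x hx0 s a p hs j'

end LawDec

end Quant

end Summit.CriticalPhenomena.PercolationContinuityZ3.Theorems
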